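/-
Copyright (c) 2026 the pub-hodgecm-mathlib formalisation cell (harness21).  Prover seat hodgecm-mathlib-K2E3-p12 (g4), Track B «K2-LIT» ∕ h413
(`stmt-HodgeConjecture-24833`), line `K2_E3_EllipticInputs`, unit U12-d, §L (Gp-a, FILE 2): UNIQUENESS OF `Gp`-INVARIANT DISTRIBUTIONS ON ONE `Gp`-ORBIT of the punctured
nilpotent cone of `𝔤𝔩₂(F)`, `Gp ≤ GL₂(F)` any OPEN subgroup.  2026-09-04.
-/
import Summits.HodgeConjecture.HodgeConjecture.Theorems.K2E3GL2NilpotentSubgroupOrbitSpace          -- (Gp-a) FILE 1 (this seat): the `Gp`-orbit `𝒪` and `μ = val^* ν`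
import Summits.HodgeConjecture.HodgeConjecture.Theorems.K2E3GL2NilpotentOneOrbitUniqueness         -- ★ p857002 (this seat, S2c): pattern; brings ★ COINV-1, van Dantzig, B–Z extension
import HarnessLib

/-!
# K2_E3 road (h413), §L — (Gp-a) FILE 2: uniqueness of `Gp`-invariant distributions on one `Gp`-orbit of `𝒩 ∖ {0} ⊂ 𝔤𝔩₂(F)`

Cell `pub/hodgecm-mathlib` (D-0151), Track B, seat K2E3-p12 (g4), §L line lead (§L RULINGS #2∕#3; MEMO v3 76bc1f2b, road «U-iso-T»).  `--supports stmt-HodgeConjecture-24833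
--as helper`; THEOREMS ONLY (no definition ∕ instance ∕ notation ∕ named fact ∕ `sorry`); never imports `Cruxes/…/Lines`.  COUNT-NEUTRAL.

THE STATEMENT (`subgroupOrbit_uniqueness`).  `F` non-archimedean local, `(κ, dx)` a Haar pair on `GL₂(𝒪_F) × F`, `Gp ≤ GL₂(F)` an OPEN subgroup (phrased as
`IsOpen {g | toConjAct g ∈ Gp}` on `Gp : Subgroup (ConjAct (GL (Fin 2) F))`), `x₀ ≠ 0` nilpotent, `𝒪 = Gp • x₀`; `T` a functional on `C_c^∞(𝔤𝔩₂(F))` that is (i) additive,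
(ii) homogeneous, (iii)_{Gp} `Ad(Gp)`-invariant, (iv) zero on test functions whose support meets no nilpotent.  THEN `∃ c, ∀ f ∈ C_c^∞(𝔤𝔩₂(F))` whose support meets the
nilpotent cone only inside `𝒪`, `T f = c · ∫_{chart⁻¹ 𝒪} f(k (tE₁₂) k⁻¹) d(κ ⊗ dx)` (the `Gp`-orbital integral `ν|_𝒪(f)`).  The case `Gp = ⊤` is ★ S2c
`gl2_nilpotentUniqueness_off_zero`; the case `Gp = det⁻¹(Nm Eˣ)` is the isotropic `U(1,1)` half of (L-B_U)′ after transport (MEMO v3 (G⁺-a)).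
[HarishChandra1999AdmissibleDistributions, §3 Thm. 3.9, Cor. 3.10 p. 10]; [Howe1974, Prop. 2]; [BernsteinZelevinsky1976, §1.18]; [RangaRao1972].

THE PROOF = ★ S2c with `G := ↥Gp` and admissible extensions «vanishing on `𝒩 ∖ 𝒪`» instead of «vanishing near `0`»: §1 restriction (`tsupport f ∩ 𝒩 ⊆ 𝒪 ⇒ f∘val ∈ S(𝒪)`,
★ FILE 1 `closure_orbit_subgroup_subset`), extension (Bernstein–Zelevinsky ★ `exists_isLocallyConstant_hasCompactSupport_extend`, then a compact open cut-off
`W ⊇ val(tsupport φ)` inside the open `(𝒩 ∖ 𝒪)ᶜ`, ★ FILE 1 `isClosed_setOf_isNilpotent_diff_orbit_subgroup`), well-definedness by clauses (i)(iv); §2 `T̄` additive,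
homogeneous, `↥Gp`-invariant on `S(𝒪)` (clause (iii)_{Gp}; `Ad(Gp)` preserves `𝒩 ∖ 𝒪`), ★ COINV-1 on the `↥Gp`-space `↥𝒪` (open orbit maps: Mathlib
`isOpenMap_smul_of_sigmaCompact`, `↥Gp` σ-compact totally disconnected locally compact as a CLOSED = open subgroup; `μ = val^* ν` ★ FILE 1), transfer ★ FILE 1
`integral_comp_val_comap_val_subgroup`.

References: [HarishChandra1999AdmissibleDistributions] Harish-Chandra (DeBacker–Sally), AMS ULECT 16 (1999), §3 pp. 8–10 · [Howe1974] Math. Ann. 208 (1974), Prop. 2 ·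
[BernsteinZelevinsky1976] Russian Math. Surveys 31:3 (1976), Prop. 1.8, §1.18 · [RangaRao1972] Ann. of Math. 96 (1972).
-/

set_option autoImplicit false
set_option linter.dupNamespace false   -- `Summit.HodgeConjecture.HodgeConjecture.…` (D-0017 nested layout; lakefile exemption for Summits)

noncomputable section

open MeasureTheory Measure Filter Topology TopologicalSpace
open scoped MatrixGroups NNReal ENNReal
open Literature.NumberTheory.Rogawski1990 Literature.NumberTheory.Automorphic Literature.NumberTheory.Automorphic.LocalFieldHaar
open Literature.NumberTheory.GaloisRepresentations Literature.NumberTheory.GaloisRepresentations.IsNonarchimedeanLocalField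
open Summit.HodgeConjecture.HodgeConjecture.Cruxes.H413.K2E3GL2RegularNilpotentOrbitalMeasure
open Summit.HodgeConjecture.HodgeConjecture.Cruxes.H413.K2E3GL2RegularNilpotentOrbitStructure
open Summit.HodgeConjecture.HodgeConjecture.Cruxes.H413.K2E3GL2RegularNilpotentOrbitPushforward
open Summit.HodgeConjecture.HodgeConjecture.Cruxes.H413.K2E3GL2RegularNilpotentOrbitSpace
open Summit.HodgeConjecture.HodgeConjecture.Cruxes.H413.K2E3GL2NilpotentSubgroupOrbitSpace

namespace Summit.HodgeConjecture.HodgeConjecture.Cruxes.H413.K2E3GL2NilpotentSubgroupOrbitUniqueness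

variable {F : Type*} [Field F] [ValuativeRel F] [TopologicalSpace F] [IsNonarchimedeanLocalField F]
  (Gp : Subgroup (ConjAct (GL (Fin 2) F))) {x₀ : Matrix (Fin 2) (Fin 2) F}

/-! ## §1  Test functions on `𝔤𝔩₂(F)` versus test functions on the `Gp`-orbit `𝒪` -/

/-- **Restriction.**  If the support of `f ∈ C_c^∞(𝔤𝔩₂(F))` meets the nilpotent cone only inside `𝒪`, then `f ∘ val` has compact support on `↥𝒪`
(`tsupport f ∩ closure 𝒪 = tsupport f ∩ 𝒪` is compact, ★ `closure_orbit_subgroup_subset`). [cite: BernsteinZelevinsky1976, §1.1] [cite: HarishChandra1999AdmissibleDistributions, §3 p. 10] -/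
theorem hasCompactSupport_comp_val_subgroup (hGp : IsOpen {g : GL (Fin 2) F | ConjAct.toConjAct g ∈ Gp}) (hx₀ : IsNilpotent x₀) (h0 : x₀ ≠ 0)
    {f : Matrix (Fin 2) (Fin 2) F → ℂ} (hf : IsLocSmooth f) (hfO : ∀ X ∈ tsupport f, IsNilpotent X → X ∈ MulAction.orbit ↥Gp x₀) :
    HasCompactSupport fun x : ↥(MulAction.orbit ↥Gp x₀) => f (x : Matrix (Fin 2) (Fin 2) F) := by
  haveI : T2Space F := (isLocalField F).toT2Space
  have hc : IsCompact ((Subtype.val : ↥(MulAction.orbit ↥Gp x₀) → Matrix (Fin 2) (Fin 2) F) ⁻¹' tsupport f) := by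
    rw [Subtype.isCompact_iff]
    have heq : (Subtype.val : ↥(MulAction.orbit ↥Gp x₀) → Matrix (Fin 2) (Fin 2) F) ''
        ((Subtype.val : ↥(MulAction.orbit ↥Gp x₀) → Matrix (Fin 2) (Fin 2) F) ⁻¹' tsupport f) = tsupport f ∩ closure (MulAction.orbit ↥Gp x₀) := by
      rw [Set.image_preimage_eq_inter_range, Subtype.range_coe]
      apply Set.Subset.antisymm
      · exact Set.inter_subset_inter_right _ subset_closure
      · rintro X ⟨hX, hXc⟩
        refine ⟨hX, ?_⟩
        rcases closure_orbit_subgroup_subset Gp hGp hx₀ h0 hXc with h | h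
        · rw [h] at hX
          exact absurd (hfO 0 hX IsNilpotent.zero) (zero_notMem_orbit_subgroup Gp hx₀ h0)
        · exact h
    rw [heq]
    exact hf.2.inter_right isClosed_closure
  exact HasCompactSupport.of_support_subset_isCompact hc fun x hx => subset_tsupport f hx

/-- **Extension off `𝒩 ∖ 𝒪`.**  Every locally constant compactly supported `φ` on `↥𝒪` extends to `Φ ∈ C_c^∞(𝔤𝔩₂(F))` with `Φ ∘ val = φ` which VANISHES ON `𝒩 ∖ 𝒪` (indeed on a
neighbourhood: `tsupport Φ ⊆ W ⊆ (𝒩 ∖ 𝒪)ᶜ` for a compact open `W`); Bernstein–Zelevinsky extension ★ `exists_isLocallyConstant_hasCompactSupport_extend`, then the cut-off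
★ `exists_isCompact_isOpen_superset_subset` around the compact `val(tsupport φ)` inside the open complement of the closed `𝒩 ∖ 𝒪` (★ FILE 1).
[cite: BernsteinZelevinsky1976, Prop. 1.8] [cite: HarishChandra1999AdmissibleDistributions, §3 p. 10] -/
theorem exists_isLocSmooth_extend_off_cone_diff (hGp : IsOpen {g : GL (Fin 2) F | ConjAct.toConjAct g ∈ Gp}) (hx₀ : IsNilpotent x₀) (h0 : x₀ ≠ 0)
    (φ : ↥(MulAction.orbit ↥Gp x₀) → ℂ) (hφ : IsLocallyConstant φ) (hφs : HasCompactSupport φ) :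
    ∃ Φ : Matrix (Fin 2) (Fin 2) F → ℂ, IsLocSmooth Φ ∧ (∀ X : Matrix (Fin 2) (Fin 2) F, IsNilpotent X → X ∉ MulAction.orbit ↥Gp x₀ → Φ X = 0) ∧
      ∀ x : ↥(MulAction.orbit ↥Gp x₀), Φ (x : Matrix (Fin 2) (Fin 2) F) = φ x := by
  haveI : T2Space F := (isLocalField F).toT2Space
  haveI : LocallyCompactSpace F := (isLocalField F).toLocallyCompactSpace
  haveI : LocallyCompactSpace (Matrix (Fin 2) (Fin 2) F) := Pi.locallyCompactSpace_of_finite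
  haveI : TotallyDisconnectedSpace F := totallyDisconnectedSpace_of_isNonarchimedeanLocalField F
  haveI : TotallyDisconnectedSpace (Matrix (Fin 2) (Fin 2) F) := inferInstanceAs (TotallyDisconnectedSpace (Fin 2 → Fin 2 → F))
  obtain ⟨Φ₀, hΦ₀, hΦ₀s, hΦ₀φ⟩ := Literature.Topology.exists_isLocallyConstant_hasCompactSupport_extend hφ hφs
  -- the compact `K = val(tsupport φ) ⊆ 𝒪 ⊆ (𝒩 ∖ 𝒪)ᶜ`, the latter open
  have hKc : IsCompact ((Subtype.val : ↥(MulAction.orbit ↥Gp x₀) → Matrix (Fin 2) (Fin 2) F) '' tsupport φ) := hφs.isCompact.image continuous_subtype_val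
  have hZ := isClosed_setOf_isNilpotent_diff_orbit_subgroup Gp hGp hx₀ h0
  have hKZ : (Subtype.val : ↥(MulAction.orbit ↥Gp x₀) → Matrix (Fin 2) (Fin 2) F) '' tsupport φ ⊆ ({N : Matrix (Fin 2) (Fin 2) F | IsNilpotent N} \ MulAction.orbit ↥Gp x₀)ᶜ := by
    rintro _ ⟨x, -, rfl⟩ ⟨-, hx⟩
    exact hx x.2
  obtain ⟨W, hWc, hWo, hKW, hWZ⟩ := Literature.Topology.exists_isCompact_isOpen_superset_subset hKc hZ.isOpen_compl hKZ
  refine ⟨W.indicator Φ₀, IsLocSmooth.indicator ⟨hΦ₀, hΦ₀s⟩ ⟨hWc.isClosed, hWo⟩, fun X hX hXO => ?_, fun x => ?_⟩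
  · have hXW : X ∉ W := fun h => hWZ h ⟨hX, hXO⟩
    exact Set.indicator_of_notMem hXW _
  · by_cases hx : (x : Matrix (Fin 2) (Fin 2) F) ∈ W
    · rw [Set.indicator_of_mem hx, hΦ₀φ x]
    · rw [Set.indicator_of_notMem hx]
      symm
      refine image_eq_zero_of_notMem_tsupport fun hxs => hx (hKW ⟨x, hxs, rfl⟩)

omit [ValuativeRel F] [IsNonarchimedeanLocalField F] in
/-- **Clause (iv) on the orbit**: a test function vanishing on `𝒪` and on `𝒩 ∖ 𝒪` vanishes on `𝒩`, so `T` kills it. [cite: HarishChandra1999AdmissibleDistributions, §3 p. 10, Cor. 3.10] -/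
theorem apply_eq_zero_of_forall_eq_zero {T : (Matrix (Fin 2) (Fin 2) F → ℂ) → ℂ}
    (hT4 : ∀ f : Matrix (Fin 2) (Fin 2) F → ℂ, IsLocSmooth f → (∀ X ∈ tsupport f, ¬ IsNilpotent X) → T f = 0)
    {D : Matrix (Fin 2) (Fin 2) F → ℂ} (hD : IsLocSmooth D) (hDZ : ∀ X : Matrix (Fin 2) (Fin 2) F, IsNilpotent X → X ∉ MulAction.orbit ↥Gp x₀ → D X = 0)
    (hDO : ∀ x : ↥(MulAction.orbit ↥Gp x₀), D (x : Matrix (Fin 2) (Fin 2) F) = 0) : T D = 0 := by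
  refine hT4 D hD fun X hX hnil => ?_
  rw [tsupport_eq_support_of_isLocallyConstant hD.1, Function.mem_support] at hX
  by_cases hXO : X ∈ MulAction.orbit ↥Gp x₀
  · exact hX (hDO ⟨X, hXO⟩)
  · exact hX (hDZ X hnil hXO)

omit [ValuativeRel F] [IsNonarchimedeanLocalField F] in
/-- **Two admissible extensions of the same `φ ∈ S(𝒪)` have the same `T`-value** (clauses (i) and (iv)). [cite: HarishChandra1999AdmissibleDistributions, §3 p. 10] -/
theorem apply_eq_apply_of_extensions {T : (Matrix (Fin 2) (Fin 2) F → ℂ) → ℂ}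
    (hT1 : ∀ f₁ f₂ : Matrix (Fin 2) (Fin 2) F → ℂ, IsLocSmooth f₁ → IsLocSmooth f₂ → T (f₁ + f₂) = T f₁ + T f₂)
    (hT4 : ∀ f : Matrix (Fin 2) (Fin 2) F → ℂ, IsLocSmooth f → (∀ X ∈ tsupport f, ¬ IsNilpotent X) → T f = 0)
    {Φ₁ Φ₂ : Matrix (Fin 2) (Fin 2) F → ℂ} (h₁ : IsLocSmooth Φ₁) (h₂ : IsLocSmooth Φ₂)
    (h₁Z : ∀ X : Matrix (Fin 2) (Fin 2) F, IsNilpotent X → X ∉ MulAction.orbit ↥Gp x₀ → Φ₁ X = 0)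
    (h₂Z : ∀ X : Matrix (Fin 2) (Fin 2) F, IsNilpotent X → X ∉ MulAction.orbit ↥Gp x₀ → Φ₂ X = 0)
    (h : ∀ x : ↥(MulAction.orbit ↥Gp x₀), Φ₁ (x : Matrix (Fin 2) (Fin 2) F) = Φ₂ (x : Matrix (Fin 2) (Fin 2) F)) :
    T Φ₁ = T Φ₂ := by
  have hD := apply_eq_zero_of_forall_eq_zero Gp hT4 (h₁.sub h₂) (fun X hX hXO => by rw [Pi.sub_apply, h₁Z X hX hXO, h₂Z X hX hXO, sub_zero])
    fun x => by rw [Pi.sub_apply, h x, sub_self]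
  calc T Φ₁ = T (Φ₂ + (Φ₁ - Φ₂)) := by rw [add_sub_cancel]
    _ = T Φ₂ + T (Φ₁ - Φ₂) := hT1 _ _ h₂ (h₁.sub h₂)
    _ = T Φ₂ := by rw [hD, add_zero]

omit [ValuativeRel F] [TopologicalSpace F] [IsNonarchimedeanLocalField F] in
/-- `Ad(h)`, `h ∈ Gp`, preserves «nilpotent and not in `𝒪`» (conjugates of nilpotents are nilpotent; `𝒪` is `Gp`-stable). [cite: BernsteinZelevinsky1976, §1.5] -/
theorem isNilpotent_conj_and_notMem_orbit (c : ↥Gp) {X : Matrix (Fin 2) (Fin 2) F} (hX : IsNilpotent X) (hXO : X ∉ MulAction.orbit ↥Gp x₀) :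
    IsNilpotent (((ConjAct.ofConjAct (c : ConjAct (GL (Fin 2) F)) : GL (Fin 2) F) : Matrix (Fin 2) (Fin 2) F) * X *
        (((ConjAct.ofConjAct (c : ConjAct (GL (Fin 2) F)))⁻¹ : GL (Fin 2) F) : Matrix (Fin 2) (Fin 2) F)) ∧
      ((ConjAct.ofConjAct (c : ConjAct (GL (Fin 2) F)) : GL (Fin 2) F) : Matrix (Fin 2) (Fin 2) F) * X *
        (((ConjAct.ofConjAct (c : ConjAct (GL (Fin 2) F)))⁻¹ : GL (Fin 2) F) : Matrix (Fin 2) (Fin 2) F) ∉ MulAction.orbit ↥Gp x₀ := by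
  have hgg : (((ConjAct.ofConjAct (c : ConjAct (GL (Fin 2) F)))⁻¹ : GL (Fin 2) F) : Matrix (Fin 2) (Fin 2) F) *
      ((ConjAct.ofConjAct (c : ConjAct (GL (Fin 2) F)) : GL (Fin 2) F) : Matrix (Fin 2) (Fin 2) F) = 1 := by
    rw [← Units.val_mul, inv_mul_cancel, Units.val_one]
  refine ⟨?_, fun hmem => hXO ?_⟩
  · rw [isNilpotent_iff_mul_self_eq_zero] at hX ⊢
    calc _ = ((ConjAct.ofConjAct (c : ConjAct (GL (Fin 2) F)) : GL (Fin 2) F) : Matrix (Fin 2) (Fin 2) F) * (X *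
          ((((ConjAct.ofConjAct (c : ConjAct (GL (Fin 2) F)))⁻¹ : GL (Fin 2) F) : Matrix (Fin 2) (Fin 2) F) *
          ((ConjAct.ofConjAct (c : ConjAct (GL (Fin 2) F)) : GL (Fin 2) F) : Matrix (Fin 2) (Fin 2) F)) * X) *
          (((ConjAct.ofConjAct (c : ConjAct (GL (Fin 2) F)))⁻¹ : GL (Fin 2) F) : Matrix (Fin 2) (Fin 2) F) := by
            simp only [Matrix.mul_assoc]
      _ = 0 := by rw [hgg, Matrix.mul_one, hX, Matrix.mul_zero, Matrix.zero_mul]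
  · -- `X = c⁻¹ • (c • X) ∈ 𝒪`
    have h1 : X = (c⁻¹ : ↥Gp) • ((c : ConjAct (GL (Fin 2) F)) • X) := by rw [Subgroup.smul_def, Subgroup.coe_inv, inv_smul_smul]
    rw [h1, Subgroup.smul_def]
    refine smul_mem_orbit_subgroup Gp ?_ c⁻¹
    rwa [ConjAct.units_smul_def]

/-! ## §2  Uniqueness on one `Gp`-orbit -/

set_option maxHeartbeats 800000 in
/-- **UNIQUENESS OF `Gp`-INVARIANT DISTRIBUTIONS ON ONE `Gp`-ORBIT OF THE PUNCTURED NILPOTENT CONE OF `𝔤𝔩₂(F)`.**  `Gp ≤ GL₂(F)` open, `x₀ ≠ 0` nilpotent, `𝒪 = Gp • x₀`,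
`(κ, dx)` a Haar pair; `T` additive, homogeneous, `Ad(Gp)`-invariant and zero on test functions whose support meets no nilpotent.  Then there is `c` with
`T f = c · ∫_{chart⁻¹ 𝒪} f(k (tE₁₂) k⁻¹) d(κ ⊗ dx)` for every `f ∈ C_c^∞(𝔤𝔩₂(F))` whose support meets `𝒩` only inside `𝒪`.  (Howe's one-orbit step for the group `Gp`; ★ COINV-1 on
the `↥Gp`-space `↥𝒪` with the invariant Radon measure `val^* ν` of ★ FILE 1.) [cite: HarishChandra1999AdmissibleDistributions, Thm. 3.9, Cor. 3.10 p. 10] [cite: Howe1974, Prop. 2]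
[cite: BernsteinZelevinsky1976, §1.18] -/
theorem subgroupOrbit_uniqueness (hGp : IsOpen {g : GL (Fin 2) F | ConjAct.toConjAct g ∈ Gp}) (hx₀ : IsNilpotent x₀) (h0 : x₀ ≠ 0)
    [MeasurableSpace F] [BorelSpace F] [MeasurableSpace (GL (Fin 2) F)] [BorelSpace (GL (Fin 2) F)]
    (κ : Measure ↥(glInt 2 F)) [IsHaarMeasure κ] (dx : Measure F) [dx.IsAddHaarMeasure]
    (T : (Matrix (Fin 2) (Fin 2) F → ℂ) → ℂ)
    (hT1 : ∀ f₁ f₂ : Matrix (Fin 2) (Fin 2) F → ℂ, IsLocSmooth f₁ → IsLocSmooth f₂ → T (f₁ + f₂) = T f₁ + T f₂)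
    (hT2 : ∀ (a : ℂ) (f : Matrix (Fin 2) (Fin 2) F → ℂ), IsLocSmooth f → T (a • f) = a * T f)
    (hT3 : ∀ x : GL (Fin 2) F, ConjAct.toConjAct x ∈ Gp → ∀ f : Matrix (Fin 2) (Fin 2) F → ℂ, IsLocSmooth f →
      T (fun X => f ((x : Matrix (Fin 2) (Fin 2) F) * X * ((x⁻¹ : GL (Fin 2) F) : Matrix (Fin 2) (Fin 2) F))) = T f)
    (hT4 : ∀ f : Matrix (Fin 2) (Fin 2) F → ℂ, IsLocSmooth f → (∀ X ∈ tsupport f, ¬ IsNilpotent X) → T f = 0) :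
    ∃ c : ℂ, ∀ f : Matrix (Fin 2) (Fin 2) F → ℂ, IsLocSmooth f → (∀ X ∈ tsupport f, IsNilpotent X → X ∈ MulAction.orbit ↥Gp x₀) →
      T f = c * ∫ p in {p : ↥(glInt 2 F) × F | ((p.1 : GL (Fin 2) F) : Matrix (Fin 2) (Fin 2) F) * !![0, p.2; 0, 0] *
          ((((p.1 : GL (Fin 2) F))⁻¹ : GL (Fin 2) F) : Matrix (Fin 2) (Fin 2) F) ∈ MulAction.orbit ↥Gp x₀},
        f (((p.1 : GL (Fin 2) F) : Matrix (Fin 2) (Fin 2) F) * !![0, p.2; 0, 0] * ((((p.1 : GL (Fin 2) F))⁻¹ : GL (Fin 2) F) : Matrix (Fin 2) (Fin 2) F)) ∂(κ.prod dx) := by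
  classical
  -- topology of `F`, `𝔤𝔩₂(F)`, `GL₂(F)`
  haveI : T2Space F := (isLocalField F).toT2Space
  haveI : LocallyCompactSpace F := (isLocalField F).toLocallyCompactSpace
  haveI : SecondCountableTopology F := secondCountableTopology_localField F
  haveI : TotallyDisconnectedSpace F := totallyDisconnectedSpace_of_isNonarchimedeanLocalField F
  haveI : CompactSpace ↥(glInt 2 F) := isCompact_iff_compactSpace.1 (isCompact_glInt 2 F)
  haveI : LocallyCompactSpace (Matrix (Fin 2) (Fin 2) F) := Pi.locallyCompactSpace_of_finite
  haveI : SecondCountableTopology (Matrix (Fin 2) (Fin 2) F) := inferInstanceAs (SecondCountableTopology (Fin 2 → Fin 2 → F))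
  haveI : TotallyDisconnectedSpace (Matrix (Fin 2) (Fin 2) F) := inferInstanceAs (TotallyDisconnectedSpace (Fin 2 → Fin 2 → F))
  haveI : SigmaCompactSpace (Matrix (Fin 2) (Fin 2) F) := inferInstanceAs (SigmaCompactSpace (Fin 2 → Fin 2 → F))
  letI : MeasurableSpace (Matrix (Fin 2) (Fin 2) F) := borel _
  haveI : BorelSpace (Matrix (Fin 2) (Fin 2) F) := ⟨rfl⟩
  haveI : LocallyCompactSpace (Matrix (Fin 2) (Fin 2) F)ᵐᵒᵖ := MulOpposite.opHomeomorph.symm.isClosedEmbedding.locallyCompactSpace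
  haveI : SigmaCompactSpace (Matrix (Fin 2) (Fin 2) F)ᵐᵒᵖ := MulOpposite.opHomeomorph.symm.isClosedEmbedding.sigmaCompactSpace
  haveI : TotallyDisconnectedSpace (Matrix (Fin 2) (Fin 2) F)ᵐᵒᵖ :=
    (MulOpposite.opHomeomorph (M := Matrix (Fin 2) (Fin 2) F)).symm.isEmbedding.isTotallyDisconnected_range.1
      (isTotallyDisconnected_of_totallyDisconnectedSpace _)
  haveI : T2Space (GL (Fin 2) F) := t2Space_generalLinearGroup F 2
  haveI : LocallyCompactSpace (GL (Fin 2) F) := Units.isClosedEmbedding_embedProduct.locallyCompactSpace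
  haveI : SigmaCompactSpace (GL (Fin 2) F) := Units.isClosedEmbedding_embedProduct.sigmaCompactSpace
  haveI : TotallyDisconnectedSpace (GL (Fin 2) F) :=
    Units.isEmbedding_embedProduct.isTotallyDisconnected_range.1 (isTotallyDisconnected_of_totallyDisconnectedSpace _)
  -- the synonym `ConjAct (GL (Fin 2) F)` and the open (hence closed) subgroup `↥Gp` as topological groups
  letI : TopologicalSpace (ConjAct (GL (Fin 2) F)) := (inferInstance : TopologicalSpace (GL (Fin 2) F))
  haveI : IsTopologicalGroup (ConjAct (GL (Fin 2) F)) := (inferInstance : IsTopologicalGroup (GL (Fin 2) F))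
  haveI : T2Space (ConjAct (GL (Fin 2) F)) := (inferInstance : T2Space (GL (Fin 2) F))
  haveI : LocallyCompactSpace (ConjAct (GL (Fin 2) F)) := (inferInstance : LocallyCompactSpace (GL (Fin 2) F))
  haveI : SigmaCompactSpace (ConjAct (GL (Fin 2) F)) := (inferInstance : SigmaCompactSpace (GL (Fin 2) F))
  haveI : TotallyDisconnectedSpace (ConjAct (GL (Fin 2) F)) := (inferInstance : TotallyDisconnectedSpace (GL (Fin 2) F))
  haveI : ContinuousSMul (ConjAct (GL (Fin 2) F)) (Matrix (Fin 2) (Fin 2) F) := by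
    refine ⟨?_⟩
    have hc1 : Continuous fun p : ConjAct (GL (Fin 2) F) × Matrix (Fin 2) (Fin 2) F =>
        ((ConjAct.ofConjAct p.1 : GL (Fin 2) F) : Matrix (Fin 2) (Fin 2) F) := Units.continuous_val.comp continuous_fst
    have hc3 : Continuous fun p : ConjAct (GL (Fin 2) F) × Matrix (Fin 2) (Fin 2) F =>
        (((ConjAct.ofConjAct p.1)⁻¹ : GL (Fin 2) F) : Matrix (Fin 2) (Fin 2) F) := Units.continuous_coe_inv.comp continuous_fst
    exact (hc1.mul continuous_snd).mul hc3
  have hGpo : IsOpen (Gp : Set (ConjAct (GL (Fin 2) F))) := hGp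
  have hGpc : IsClosed (Gp : Set (ConjAct (GL (Fin 2) F))) := Subgroup.isClosed_of_isOpen Gp hGpo
  haveI : LocallyCompactSpace ↥Gp := hGpc.isClosedEmbedding_subtypeVal.locallyCompactSpace
  haveI : SigmaCompactSpace ↥Gp := hGpc.sigmaCompactSpace
  -- the orbit `X = ↥𝒪`
  haveI : LocallyCompactSpace ↥(MulAction.orbit ↥Gp x₀) := locallyCompactSpace_orbit_subgroup Gp hGp hx₀ h0
  haveI : ContinuousSMul ↥Gp ↥(MulAction.orbit ↥Gp x₀) := Literature.MeasureTheory.Group.continuousSMul_orbit _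
  have hopen : ∀ x : ↥(MulAction.orbit ↥Gp x₀), IsOpenMap fun g : ↥Gp => g • x := fun x => isOpenMap_smul_of_sigmaCompact x
  obtain ⟨K₀, hK₀o, hK₀c⟩ := Literature.Topology.Algebra.exists_isCompact_isOpen_subgroup (G := ↥Gp)
  -- the invariant Radon measure `μ = val^* ν` (★ FILE 1)
  haveI := isFiniteMeasureOnCompacts_comap_val_subgroup Gp (F := F) κ dx hGp hx₀ h0
  haveI := smulInvariantMeasure_comap_val_subgroup Gp (F := F) κ dx hGp hx₀ h0
  haveI := Literature.MeasureTheory.Group.isOpenPosMeasure_of_smulInvariantMeasure_ne_zero (G := ↥Gp)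
    (fun x : ↥(MulAction.orbit ↥Gp x₀) => show Continuous fun g : ↥Gp => g • x by fun_prop) _ (comap_val_subgroup_ne_zero Gp (F := F) κ dx hGp hx₀ h0)
  -- the functional `T̄` on `S(𝒪)`: `T` of an admissible extension
  obtain ⟨Tbar, hTbar_def⟩ : ∃ Tbar : (↥(MulAction.orbit ↥Gp x₀) → ℂ) → ℂ,
      ∀ φ, Tbar φ = if h : IsLocallyConstant φ ∧ HasCompactSupport φ then
        T (Classical.choose (exists_isLocSmooth_extend_off_cone_diff Gp hGp hx₀ h0 φ h.1 h.2)) else 0 := ⟨_, fun _ => rfl⟩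
  have hTbar : ∀ φ : ↥(MulAction.orbit ↥Gp x₀) → ℂ, IsLocallyConstant φ → HasCompactSupport φ →
      ∀ Φ : Matrix (Fin 2) (Fin 2) F → ℂ, IsLocSmooth Φ → (∀ X : Matrix (Fin 2) (Fin 2) F, IsNilpotent X → X ∉ MulAction.orbit ↥Gp x₀ → Φ X = 0) →
      (∀ x : ↥(MulAction.orbit ↥Gp x₀), Φ (x : Matrix (Fin 2) (Fin 2) F) = φ x) → Tbar φ = T Φ := by
    intro φ hφ hφs Φ hΦ hΦZ hΦφ
    have h : IsLocallyConstant φ ∧ HasCompactSupport φ := ⟨hφ, hφs⟩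
    rw [hTbar_def, dif_pos h]
    obtain ⟨hE, hEZ, hEφ⟩ := Classical.choose_spec (exists_isLocSmooth_extend_off_cone_diff Gp hGp hx₀ h0 φ h.1 h.2)
    exact apply_eq_apply_of_extensions Gp hT1 hT4 hE hΦ hEZ hΦZ fun x => by rw [hEφ, hΦφ]
  -- `T̄` is additive, homogeneous and `Gp`-invariant on `S(𝒪)`
  have hadd : ∀ φ ψ : ↥(MulAction.orbit ↥Gp x₀) → ℂ,
      IsLocallyConstant φ → HasCompactSupport φ → IsLocallyConstant ψ → HasCompactSupport ψ → Tbar (φ + ψ) = Tbar φ + Tbar ψ := by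
    intro φ ψ hφ hφs hψ hψs
    obtain ⟨Φ, hΦ, hΦZ, hΦφ⟩ := exists_isLocSmooth_extend_off_cone_diff Gp hGp hx₀ h0 φ hφ hφs
    obtain ⟨Ψ, hΨ, hΨZ, hΨψ⟩ := exists_isLocSmooth_extend_off_cone_diff Gp hGp hx₀ h0 ψ hψ hψs
    rw [hTbar (φ + ψ) (hφ.add hψ) (hφs.add hψs) (Φ + Ψ) (hΦ.add hΨ)
        (fun X hX hXO => by rw [Pi.add_apply, hΦZ X hX hXO, hΨZ X hX hXO, add_zero]) (fun x => by simp only [Pi.add_apply, hΦφ, hΨψ]),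
      hTbar φ hφ hφs Φ hΦ hΦZ hΦφ, hTbar ψ hψ hψs Ψ hΨ hΨZ hΨψ]
    exact hT1 Φ Ψ hΦ hΨ
  have hsmul : ∀ (a : ℂ) (φ : ↥(MulAction.orbit ↥Gp x₀) → ℂ), IsLocallyConstant φ → HasCompactSupport φ → Tbar (a • φ) = a * Tbar φ := by
    intro a φ hφ hφs
    obtain ⟨Φ, hΦ, hΦZ, hΦφ⟩ := exists_isLocSmooth_extend_off_cone_diff Gp hGp hx₀ h0 φ hφ hφs
    rw [hTbar (a • φ) (hφ.comp fun z => a • z) hφs.smul_left (a • Φ) (hΦ.const_smul a)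
        (fun X hX hXO => by rw [Pi.smul_apply, hΦZ X hX hXO, smul_zero]) (fun x => by simp only [Pi.smul_apply, hΦφ]),
      hTbar φ hφ hφs Φ hΦ hΦZ hΦφ]
    exact hT2 a Φ hΦ
  have hinv : ∀ φ : ↥(MulAction.orbit ↥Gp x₀) → ℂ, IsLocallyConstant φ → HasCompactSupport φ → ∀ g : ↥Gp, Tbar (fun y => φ (g • y)) = Tbar φ := by
    intro φ hφ hφs g
    obtain ⟨Φ, hΦ, hΦZ, hΦφ⟩ := exists_isLocSmooth_extend_off_cone_diff Gp hGp hx₀ h0 φ hφ hφs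
    have hc := continuous_conj (F := F) (ConjAct.ofConjAct (g : ConjAct (GL (Fin 2) F)))
    have hΦ' : IsLocSmooth fun Y : Matrix (Fin 2) (Fin 2) F => Φ (((ConjAct.ofConjAct (g : ConjAct (GL (Fin 2) F)) : GL (Fin 2) F) : Matrix (Fin 2) (Fin 2) F) * Y *
        (((ConjAct.ofConjAct (g : ConjAct (GL (Fin 2) F)))⁻¹ : GL (Fin 2) F) : Matrix (Fin 2) (Fin 2) F)) :=
      ⟨hΦ.1.comp_continuous hc, hΦ.2.comp_homeomorph (Homeomorph.smul (g : ConjAct (GL (Fin 2) F)))⟩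
    rw [hTbar (fun y => φ (g • y)) (hφ.comp_continuous (continuous_const_smul g)) (hφs.comp_homeomorph (Homeomorph.smul g)) _ hΦ'
        (fun X hX hXO => by
          obtain ⟨h1, h2⟩ := isNilpotent_conj_and_notMem_orbit Gp g hX hXO
          exact hΦZ _ h1 h2)
        (fun x => by rw [← hΦφ (g • x), MulAction.orbit.coe_smul, Subgroup.smul_def, ConjAct.units_smul_def]),
      hTbar φ hφ hφs Φ hΦ hΦZ hΦφ]
    exact hT3 (ConjAct.ofConjAct (g : ConjAct (GL (Fin 2) F))) (by rw [ConjAct.toConjAct_ofConjAct]; exact g.2) Φ hΦ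
  -- ★ COINV-1 on the `↥Gp`-space `↥𝒪`
  obtain ⟨c, hc⟩ := Literature.MeasureTheory.Group.exists_forall_apply_eq_const_mul_integral_of_smul_invariant_of_additive K₀ hK₀o hK₀c hopen
    (Measure.comap (Subtype.val : ↥(MulAction.orbit ↥Gp x₀) → Matrix (Fin 2) (Fin 2) F)
      ((κ.prod dx).map fun p : ↥(glInt 2 F) × F =>
        ((p.1 : GL (Fin 2) F) : Matrix (Fin 2) (Fin 2) F) * !![0, p.2; 0, 0] * ((((p.1 : GL (Fin 2) F))⁻¹ : GL (Fin 2) F) : Matrix (Fin 2) (Fin 2) F)))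
    Tbar hadd hsmul hinv
  refine ⟨c, fun f hf hfO => ?_⟩
  -- transfer: `f` is an admissible extension of `f ∘ val ∈ S(𝒪)`
  have hφ : IsLocallyConstant fun x : ↥(MulAction.orbit ↥Gp x₀) => f (x : Matrix (Fin 2) (Fin 2) F) := hf.1.comp_continuous continuous_subtype_val
  have hφs := hasCompactSupport_comp_val_subgroup Gp hGp hx₀ h0 hf hfO
  have hfZ : ∀ X : Matrix (Fin 2) (Fin 2) F, IsNilpotent X → X ∉ MulAction.orbit ↥Gp x₀ → f X = 0 :=
    fun X hX hXO => image_eq_zero_of_notMem_tsupport fun hXs => hXO (hfO X hXs hX)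
  have key := hTbar _ hφ hφs f hf hfZ fun _ => rfl
  have hc' : Tbar (fun x : ↥(MulAction.orbit ↥Gp x₀) => f (x : Matrix (Fin 2) (Fin 2) F)) =
      c * ∫ x : ↥(MulAction.orbit ↥Gp x₀), f (x : Matrix (Fin 2) (Fin 2) F) ∂(Measure.comap (Subtype.val : ↥(MulAction.orbit ↥Gp x₀) → Matrix (Fin 2) (Fin 2) F)
        ((κ.prod dx).map fun p : ↥(glInt 2 F) × F =>
          ((p.1 : GL (Fin 2) F) : Matrix (Fin 2) (Fin 2) F) * !![0, p.2; 0, 0] * ((((p.1 : GL (Fin 2) F))⁻¹ : GL (Fin 2) F) : Matrix (Fin 2) (Fin 2) F))) :=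
    hc _ hφ hφs
  rw [← key, hc', integral_comp_val_comap_val_subgroup Gp κ dx hGp hx₀ h0 hf.continuous.aestronglyMeasurable]

end Summit.HodgeConjecture.HodgeConjecture.Cruxes.H413.K2E3GL2NilpotentSubgroupOrbitUniqueness
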